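/-
Copyright (c) 2026. All rights reserved.
Released under Apache 2.0 license as described in the file LICENSE.
Authors: HodgeCM publication cell (pub-hodgecm), model-construction sub-cell, construction prover `mc-unitary-3`.
-/
import Literature.NumberTheory.Weil1964.AdelicMetaplecticTransport
import Literature.NumberTheory.Automorphic.UnitaryGroupDirectSum
import HarnessLib

/-!
# Reindexing `Mp_ψ(W_T) ≃* Mp_ψ(W_{reindex e e T})` of the adelic Schrödinger model along `e : ι ≃ ι′`

The second instance of the transport of structure of `AdelicMetaplecticTransport` §1
([MoeglinVignerasWaldspurger1987, Chap. 2 II.1 (A)–(B)]: `Mp_ψ(W)`, its projection and its Weil representation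
are natural in the pair (symplectic space, model of the Heisenberg representation)).  Relabelling the COORDINATES
of `X = F^ι` along a bijection `e : ι ≃ ι′` moves the Gram matrix `T` of `W_T = (𝔸_F^ι × 𝔸_F^ι, polar β_T)` to
`reindex e e T`, the symplectic space by unitary-2's `reindexW e : (x, y) ↦ (x ∘ e⁻¹, y ∘ e⁻¹)`
(`UnitaryGroupDirectSum` §2, group level `spReindex e T = symplecticGroupCongr (reindexW e)`), and the model
`𝒮(𝔸_F^ι)` by the REINDEXING OPERATOR `R_e Φ = Φ ∘ (· ∘ e)`; and `R_e ρ_T(h) = ρ_{reindex e e T}(W_e h) R_e`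
(`adelicSchrodinger_reindex`: `(w ∘ e) ⬝ᵥ T y = w ⬝ᵥ (reindex e e T)(y ∘ e⁻¹)` and `(w + x ∘ e⁻¹) ∘ e = w ∘ e + x`).

## What is here (sorry-free; no new Literature facts)

§1 THE OPERATOR `R_e` — `piSBReindex K e : piSchwartzBruhat K ι ≃ₗ[ℂ] piSchwartzBruhat K ι′` (membership by the
tree's `comp_equiv_mem_piSchwartzBruhat`), its archimedean and finite factors `schwartzReindexCLM K e`
(Mathlib `SchwartzMap.compCLMOfContinuousLinearEquiv`) and `finSBReindex K e`, the pure-tensor formula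
`piSBReindex_tmul : R_e (φ ⊗ Φ_f) = R_e^∞ φ ⊗ R_e^f Φ_f` (w.r.t. `piSchwartzBruhatEquiv`), and the transport of
LF-continuity `isLFContinuous_reindexConj` / `reindexConj_mem_lfUnits_iff : R_e⁻¹ ≫ M ≫ R_e ∈ lfUnits K ι′ ↔ M ∈ lfUnits K ι`.
§2 `Θ ∘ R_e = Θ` — `thetaDist_comp_equiv`, `thetaDistLM_piSBReindex` (reindexing `Σ_{ξ ∈ F^ι}`).
§3 THE REINDEXING `adelicMpReindex F e T : adelicMp F ι T ≃* adelicMp F ι′ (reindex e e T)` =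
`MpPsi.transport (reindexW e) _ ρ_{reindex T} ρ_T (piSBReindex e) _`, with `toOp_adelicMpReindex`
(`= R_e⁻¹ ≫ toOp p ≫ R_e`, pointwise `coe_toOp_adelicMpReindex_apply`), `omegaPsi_adelicMpReindex_apply`,
`proj_adelicMpReindex : π(reindex p) = spReindex e T (π p)` (`rfl`), `coe_proj_adelicMpReindex_apply`,
`adelicMpReindex_mem_adelicMpCont_iff`, `adelicMpReindex_mem_adelicMpTheta_iff`, `continuous_adelicMpReindex`,
`adelicMpReindex_eq_of_proj_eq` (uniqueness against `Θ`-fixing lifts).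
§4 ON THE GROUP OF RECORD — `adelicMpContReindex F e T : adelicMpCont F ι T ≃* adelicMpCont F ι′ (reindex e e T)`,
`adelicMpCont.omega_reindex_apply`, `adelicMpCont.proj_reindex` (`= spReindex e T ∘ π`, `rfl`),
`coe_adelicMpContReindex_mem_adelicMpTheta_iff`, `continuous_adelicMpContReindex`.
§5 CONSUMER ONE-LINERS — `adelicMpCont.omega_comp_relabel` (a relabelled splitting has the same `ω`),
`adelicMpCont.omega_comp_reindex_apply`.

Consumers (publication cell, junction `E`, the `(12)`-side of the see-saw): a splitting over the Gram matrix
indexed by `ι₁ ⊕ ι₂` (or `Fin n × Fin 2`) is moved to the index type of record by `adelicMpContReindex e T ∘ s`;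
matrix coefficients `(ω(s′ p) Ψ)(x) = (ω(s p) (R_e⁻¹ Ψ))(x ∘ e)` are those of `s` (so coefficient-continuity and theta
majorants transfer verbatim).
-/

set_option autoImplicit false

noncomputable section

open NumberField
open scoped Matrix

namespace Literature.NumberTheory.Weil1964

open Literature.RepresentationTheory.HeisenbergGroup Literature.NumberTheory.Automorphic
open Literature.NumberTheory.Automorphic.UnitaryGroup (symplecticGroupCongr coe_symplecticGroupCongr_apply reindexW
  reindexW_apply reindexW_symm_apply toLinearMap₂'_reindex spReindex)
open NumberField.mixedEmbedding IsDedekindDomain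
open scoped SchwartzMap TensorProduct Classical

/-! ## §1 Reindexing the coordinates of `𝒮(𝔸_K^ι)`: the operator `R_e Φ = Φ ∘ (· ∘ e)` and its tensor structure -/

section Operators

variable (K : Type) [Field K] [NumberField K] {ι ι' : Type} [Fintype ι] [Fintype ι'] (e : ι ≃ ι')

omit [Fintype ι] [Fintype ι'] in
/-- archimedean coordinates commute with reindexing. [folklore] -/
theorem piArch_comp_equiv (w : ι' → AdeleRing (𝓞 K) K) : piArch K ι (w ∘ e) = piArch K ι' w ∘ e := rfl

omit [Fintype ι] [Fintype ι'] in
/-- finite coordinates commute with reindexing. [folklore] -/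
theorem piFinite_comp_equiv (w : ι' → AdeleRing (𝓞 K) K) : piFinite K ι (w ∘ e) = piFinite K ι' w ∘ e := rfl

/-- **The archimedean reindexing operator** `φ ↦ φ ∘ (· ∘ e)`, `𝓢((K ⊗ ℝ)^ι) →L 𝓢((K ⊗ ℝ)^{ι′})` (Mathlib
`SchwartzMap.compCLMOfContinuousLinearEquiv` along `w ↦ w ∘ e`). [folklore] -/
def schwartzReindexCLM : 𝓢((ι → mixedSpace K), ℂ) →L[ℂ] 𝓢((ι' → mixedSpace K), ℂ) :=
  SchwartzMap.compCLMOfContinuousLinearEquiv ℂ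
    (LinearEquiv.funCongrLeft ℝ (mixedSpace K) e).toContinuousLinearEquiv

/-- formula `(R_e φ)(w) = φ (w ∘ e)`. [folklore] -/
@[simp] theorem schwartzReindexCLM_apply (φ : 𝓢((ι → mixedSpace K), ℂ)) (w : ι' → mixedSpace K) :
    schwartzReindexCLM K e φ w = φ (w ∘ e) := rfl

variable {K} in
omit [Fintype ι] [Fintype ι'] in
/-- `𝒮((𝔸_{K,f})^ι)` is stable under reindexing of the coordinates. [folklore] -/
theorem comp_equiv_mem_finSchwartzBruhat {Φ : (ι → FiniteAdeleRing (𝓞 K) K) → ℂ}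
    (h : Φ ∈ SchwartzBruhat (ι → FiniteAdeleRing (𝓞 K) K)) (e : ι ≃ ι') :
    (fun b : ι' → FiniteAdeleRing (𝓞 K) K => Φ (b ∘ e)) ∈ SchwartzBruhat (ι' → FiniteAdeleRing (𝓞 K) K) := by
  obtain ⟨hlc, hcs⟩ := (mem_schwartzBruhat_iff).1 h
  exact (mem_schwartzBruhat_iff).2
    ⟨hlc.comp_continuous (piCompHomeomorph (FiniteAdeleRing (𝓞 K) K) e).continuous,
      hcs.comp_homeomorph (piCompHomeomorph (FiniteAdeleRing (𝓞 K) K) e)⟩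

omit [Fintype ι] [Fintype ι'] in
/-- **The finite reindexing operator** `Φ_f ↦ Φ_f ∘ (· ∘ e)`, `𝒮((𝔸_{K,f})^ι) ≃ₗ 𝒮((𝔸_{K,f})^{ι′})`. [folklore] -/
def finSBReindex : FinSB K ι ≃ₗ[ℂ] FinSB K ι' where
  toFun Φ := ⟨fun b => (Φ : (ι → FiniteAdeleRing (𝓞 K) K) → ℂ) (b ∘ e), comp_equiv_mem_finSchwartzBruhat Φ.2 e⟩
  invFun Ψ := ⟨fun a => (Ψ : (ι' → FiniteAdeleRing (𝓞 K) K) → ℂ) (a ∘ e.symm),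
    comp_equiv_mem_finSchwartzBruhat Ψ.2 e.symm⟩
  map_add' _ _ := rfl
  map_smul' _ _ := rfl
  left_inv Φ := Subtype.ext <| funext fun a =>
    congrArg (Φ : (ι → FiniteAdeleRing (𝓞 K) K) → ℂ) (funext fun i => congrArg a (e.symm_apply_apply i))
  right_inv Ψ := Subtype.ext <| funext fun b =>
    congrArg (Ψ : (ι' → FiniteAdeleRing (𝓞 K) K) → ℂ) (funext fun i => congrArg b (e.apply_symm_apply i))

omit [Fintype ι] [Fintype ι'] in
/-- formula `(R_e Φ_f)(b) = Φ_f (b ∘ e)`. [folklore] -/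
@[simp] theorem coe_finSBReindex_apply (Φ : FinSB K ι) (b : ι' → FiniteAdeleRing (𝓞 K) K) :
    (finSBReindex K e Φ : (ι' → FiniteAdeleRing (𝓞 K) K) → ℂ) b = (Φ : (ι → FiniteAdeleRing (𝓞 K) K) → ℂ) (b ∘ e) :=
  rfl

/-- **THE REINDEXING OPERATOR `R_e : 𝒮(𝔸_K^ι) ≃ₗ 𝒮(𝔸_K^{ι′})`, `(R_e Φ)(w) = Φ (w ∘ e)`** (inverse `R_{e⁻¹}`;
membership by `comp_equiv_mem_piSchwartzBruhat`). [folklore] -/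
def piSBReindex : piSchwartzBruhat K ι ≃ₗ[ℂ] piSchwartzBruhat K ι' where
  toFun Φ := ⟨fun w => (Φ : (ι → AdeleRing (𝓞 K) K) → ℂ) (w ∘ e), comp_equiv_mem_piSchwartzBruhat Φ.2 e⟩
  invFun Ψ := ⟨fun u => (Ψ : (ι' → AdeleRing (𝓞 K) K) → ℂ) (u ∘ e.symm), comp_equiv_mem_piSchwartzBruhat Ψ.2 e.symm⟩
  map_add' _ _ := rfl
  map_smul' _ _ := rfl
  left_inv Φ := Subtype.ext <| funext fun u =>
    congrArg (Φ : (ι → AdeleRing (𝓞 K) K) → ℂ) (funext fun i => congrArg u (e.symm_apply_apply i))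
  right_inv Ψ := Subtype.ext <| funext fun w =>
    congrArg (Ψ : (ι' → AdeleRing (𝓞 K) K) → ℂ) (funext fun i => congrArg w (e.apply_symm_apply i))

/-- formula `(R_e Φ)(w) = Φ (w ∘ e)`. [folklore] -/
@[simp] theorem coe_piSBReindex_apply (Φ : piSchwartzBruhat K ι) (w : ι' → AdeleRing (𝓞 K) K) :
    (piSBReindex K e Φ : (ι' → AdeleRing (𝓞 K) K) → ℂ) w = (Φ : (ι → AdeleRing (𝓞 K) K) → ℂ) (w ∘ e) :=
  rfl

/-- formula `(R_e⁻¹ Ψ)(u) = Ψ (u ∘ e⁻¹)`. [folklore] -/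
@[simp] theorem coe_piSBReindex_symm_apply (Ψ : piSchwartzBruhat K ι') (u : ι → AdeleRing (𝓞 K) K) :
    ((piSBReindex K e).symm Ψ : (ι → AdeleRing (𝓞 K) K) → ℂ) u = (Ψ : (ι' → AdeleRing (𝓞 K) K) → ℂ) (u ∘ e.symm) :=
  rfl

/-- `R_e⁻¹ = R_{e⁻¹}`. [folklore] -/
theorem piSBReindex_symm : (piSBReindex K e).symm = piSBReindex K e.symm := rfl

/-- `R_{e⁻¹} (R_e Φ) = Φ`. [folklore] -/
@[simp] theorem piSBReindex_symm_apply_apply' (Φ : piSchwartzBruhat K ι) :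
    piSBReindex K e.symm (piSBReindex K e Φ) = Φ :=
  (piSBReindex K e).symm_apply_apply Φ

/-- **`R_e` is a pure tensor operator on pure tensors**: `R_e (φ ⊗ Φ_f) = R_e^∞ φ ⊗ R_e^f Φ_f`. [folklore] -/
theorem piSBReindex_tmul (φ : 𝓢((ι → mixedSpace K), ℂ)) (Φf : FinSB K ι) :
    piSBReindex K e (piSchwartzBruhatEquiv K ι (φ ⊗ₜ[ℂ] Φf)) =
      piSchwartzBruhatEquiv K ι' (schwartzReindexCLM K e φ ⊗ₜ[ℂ] finSBReindex K e Φf) := by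
  apply Subtype.ext
  funext w
  rw [coe_piSBReindex_apply, coe_piSchwartzBruhatEquiv_tmul, coe_piSchwartzBruhatEquiv_tmul]
  show φ (piArch K ι (w ∘ e)) * (Φf : (ι → FiniteAdeleRing (𝓞 K) K) → ℂ) (piFinite K ι (w ∘ e)) =
    φ (piArch K ι' w ∘ e) * (Φf : (ι → FiniteAdeleRing (𝓞 K) K) → ℂ) (piFinite K ι' w ∘ e)
  rfl

variable {K} in
/-- **LF-continuity is transported by reindexing**: if `M` is LF-continuous on `𝒮(𝔸_K^ι)` then
`R_e M R_{e⁻¹}` is LF-continuous on `𝒮(𝔸_K^{ι′})` (expansion blocks `R_e^∞ A_j R_{e⁻¹}^∞`, vectors `R_e^f Ψ_j`).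
[cite: Weil1964, Chap. I n° 11 pp. 155–156] -/
theorem isLFContinuous_reindexConj {M : piSchwartzBruhat K ι →ₗ[ℂ] piSchwartzBruhat K ι} (hM : IsLFContinuous M)
    (e : ι ≃ ι') :
    IsLFContinuous ((piSBReindex K e).toLinearMap ∘ₗ M ∘ₗ (piSBReindex K e.symm).toLinearMap) := by
  intro Φf'
  obtain ⟨κ, _, A, Ψ, hA⟩ := hM (finSBReindex K e.symm Φf')
  refine ⟨κ, inferInstance, fun j => (schwartzReindexCLM K e).comp ((A j).comp (schwartzReindexCLM K e.symm)),
    fun j => finSBReindex K e (Ψ j), fun φ' => ?_⟩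
  simp only [LinearMap.comp_apply, LinearEquiv.coe_toLinearMap, piSBReindex_tmul, hA, map_sum,
    ContinuousLinearMap.comp_apply]

variable {K} in
/-- **`GL(𝒮)ᶜᵒⁿᵗ` is transported by reindexing**: `R_e⁻¹ ≫ M ≫ R_e ∈ lfUnits K ι′` for `M ∈ lfUnits K ι`. [folklore] -/
theorem reindexConj_mem_lfUnits {M : piSchwartzBruhat K ι ≃ₗ[ℂ] piSchwartzBruhat K ι} (hM : M ∈ lfUnits K ι)
    (e : ι ≃ ι') : ((piSBReindex K e).symm.trans M).trans (piSBReindex K e) ∈ lfUnits K ι' :=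
  ⟨(isLFContinuous_reindexConj hM.1 e).congr fun _ => rfl, (isLFContinuous_reindexConj hM.2 e).congr fun _ => rfl⟩

variable {K} in
/-- and conversely (apply the previous statement to `e⁻¹`). [folklore] -/
theorem reindexConj_mem_lfUnits_iff (M : piSchwartzBruhat K ι ≃ₗ[ℂ] piSchwartzBruhat K ι) (e : ι ≃ ι') :
    ((piSBReindex K e).symm.trans M).trans (piSBReindex K e) ∈ lfUnits K ι' ↔ M ∈ lfUnits K ι := by
  refine ⟨fun h => ?_, fun h => reindexConj_mem_lfUnits h e⟩
  have h' := reindexConj_mem_lfUnits h e.symm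
  have hM : M = ((piSBReindex K e.symm).symm.trans (((piSBReindex K e).symm.trans M).trans (piSBReindex K e))).trans
      (piSBReindex K e.symm) :=
    LinearEquiv.ext fun Φ => by
      simp only [LinearEquiv.trans_apply, piSBReindex_symm, Equiv.symm_symm, piSBReindex_symm_apply_apply']
  rw [hM]
  exact h'

end Operators

/-! ## §2 `Θ ∘ R_e = Θ` -/

section Theta

variable (F : Type) [Field F] [NumberField F] {ι ι' : Type} [Fintype ι] [Fintype ι'] (e : ι ≃ ι')

omit [Fintype ι] [Fintype ι'] in
/-- `Σ_{ξ′ ∈ F^{ι′}} Φ(ξ′ ∘ e) = Σ_{ξ ∈ F^ι} Φ(ξ)` (reindexing the sum along `ξ′ ↦ ξ′ ∘ e`). [folklore] -/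
theorem thetaDist_comp_equiv (Φ : (ι → AdeleRing (𝓞 F) F) → ℂ) :
    thetaDist F ι' (fun w => Φ (w ∘ e)) = thetaDist F ι Φ := by
  rw [thetaDist_def, thetaDist_def]
  exact Equiv.tsum_eq (Equiv.arrowCongr e (Equiv.refl F)).symm fun ξ : ι → F => Φ (ratPt F ι ξ)

/-- **`Θ (R_e Φ) = Θ Φ`.** [cite: Weil1964, Chap. III n° 41 Thm 6 p. 193] -/
@[simp] theorem thetaDistLM_piSBReindex (Φ : piSchwartzBruhat F ι) :
    thetaDistLM F ι' (piSBReindex F e Φ) = thetaDistLM F ι Φ := by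
  rw [thetaDistLM_apply, thetaDistLM_apply]
  exact thetaDist_comp_equiv F e _

end Theta

/-! ## §3 The reindexing `Mp_ψ(W_T) ≃* Mp_ψ(W_{reindex e e T})` of the adelic Schrödinger model -/

section Reindex

variable (F : Type) [Field F] [NumberField F] {ι ι' : Type} [Fintype ι] [Fintype ι'] [DecidableEq ι] [DecidableEq ι']
  (e : ι ≃ ι') (T : Matrix ι ι (AdeleRing (𝓞 F) F))

/-- **`W_e : (x, y) ↦ (x ∘ e⁻¹, y ∘ e⁻¹)` is form-compatible** for `β_T` and `β_{reindex e e T}` (unitary-2's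
`reindexW`, `toLinearMap₂'_reindex`). [folklore] -/
theorem polar_reindexW (v w : (ι → AdeleRing (𝓞 F) F) × (ι → AdeleRing (𝓞 F) F)) :
    polar (adelicForm F ι' (Matrix.reindex e e T)) (reindexW (AdeleRing (𝓞 F) F) e v) (reindexW (AdeleRing (𝓞 F) F) e w) =
      polar (adelicForm F ι T) v w := by
  rw [polar_apply, polar_apply, reindexW_apply, reindexW_apply]
  exact toLinearMap₂'_reindex e T v.1 w.2

/-- `w ⬝ᵥ ((reindex e e T) (y ∘ e⁻¹)) = (w ∘ e) ⬝ᵥ (T y)`. [folklore] -/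
theorem dotProduct_reindex_mulVec (w : ι' → AdeleRing (𝓞 F) F) (y : ι → AdeleRing (𝓞 F) F) :
    w ⬝ᵥ (Matrix.reindex e e T *ᵥ (y ∘ e.symm)) = (w ∘ e) ⬝ᵥ (T *ᵥ y) := by
  have h := toLinearMap₂'_reindex e T (w ∘ e) y
  rw [Matrix.toLinearMap₂'_apply', Matrix.toLinearMap₂'_apply'] at h
  have hw : (w ∘ e) ∘ e.symm = w := funext fun i => congrArg w (e.apply_symm_apply i)
  rwa [hw] at h

omit [Fintype ι] [Fintype ι'] [DecidableEq ι] [DecidableEq ι'] in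
/-- `(w + x ∘ e⁻¹) ∘ e = w ∘ e + x`. [folklore] -/
theorem add_comp_equiv (w : ι' → AdeleRing (𝓞 F) F) (x : ι → AdeleRing (𝓞 F) F) :
    (w + x ∘ e.symm) ∘ e = w ∘ e + x :=
  funext fun i => by simp

/-- **`R_e` intertwines the Schrödinger representations**: `ρ_{reindex e e T}(W_e h) (R_e Φ) = R_e (ρ_T(h) Φ)`,
pointwise. [cite: MoeglinVignerasWaldspurger1987, Chap. 2 I.4 Exemple (1)] -/
theorem adelicSchrodinger_reindex_apply (h : AdelicHeisenberg F ι T) (Φ : piSchwartzBruhat F ι)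
    (w : ι' → AdeleRing (𝓞 F) F) :
    ((adelicSchrodinger F ι' (Matrix.reindex e e T)
        (heisenbergCongr (reindexW (AdeleRing (𝓞 F) F) e) (polar_reindexW F e T) h) (piSBReindex F e Φ) :
          piSchwartzBruhat F ι') : (ι' → AdeleRing (𝓞 F) F) → ℂ) w =
      ((piSBReindex F e (adelicSchrodinger F ι T h Φ) : piSchwartzBruhat F ι') : (ι' → AdeleRing (𝓞 F) F) → ℂ) w := by
  rw [coe_piSBReindex_apply, adelicSchrodinger_apply, adelicSchrodinger_apply, heisenbergCongr_t, heisenbergCongr_v,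
    reindexW_apply, coe_piSBReindex_apply, dotProduct_reindex_mulVec, add_comp_equiv]

/-- the same as an identity of vectors of `𝒮(𝔸_F^{ι′})`. [cite: MoeglinVignerasWaldspurger1987, Chap. 2 I.4 Exemple (1)] -/
theorem adelicSchrodinger_reindex (h : AdelicHeisenberg F ι T) (Φ : piSchwartzBruhat F ι) :
    piSBReindex F e (adelicSchrodinger F ι T h Φ) =
      adelicSchrodinger F ι' (Matrix.reindex e e T)
        (heisenbergCongr (reindexW (AdeleRing (𝓞 F) F) e) (polar_reindexW F e T) h) (piSBReindex F e Φ) :=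
  (Subtype.ext (funext fun w => adelicSchrodinger_reindex_apply F e T h Φ w)).symm

/-- **THE REINDEXING `Mp_ψ(W_T) ≃* Mp_ψ(W_{reindex e e T})`**, `(g, M) ↦ (W_e g W_e⁻¹, R_e M R_e⁻¹)`: the transport
of `AdelicMetaplecticTransport` §1 along `(W_e, R_e)`. [cite: MoeglinVignerasWaldspurger1987, Chap. 2 II.1 (A)–(B)] -/
def adelicMpReindex : adelicMp F ι T ≃* adelicMp F ι' (Matrix.reindex e e T) :=
  MpPsi.transport (reindexW (AdeleRing (𝓞 F) F) e) (polar_reindexW F e T)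
    (adelicSchrodinger F ι' (Matrix.reindex e e T)) (adelicSchrodinger F ι T) (piSBReindex F e)
    (adelicSchrodinger_reindex F e T)

/-- **`toOp (reindex p) = R_e⁻¹ ≫ toOp p ≫ R_e`.** [folklore] -/
@[simp] theorem toOp_adelicMpReindex (p : adelicMp F ι T) :
    MpPsi.toOp (adelicSchrodinger F ι' (Matrix.reindex e e T)) (adelicMpReindex F e T p) =
      ((piSBReindex F e).symm.trans (MpPsi.toOp (adelicSchrodinger F ι T) p)).trans (piSBReindex F e) :=
  rfl

/-- pointwise: `(toOp (reindex p) Ψ)(w) = (toOp p (R_e⁻¹ Ψ))(w ∘ e)`. [folklore] -/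
theorem coe_toOp_adelicMpReindex_apply (p : adelicMp F ι T) (Ψ : piSchwartzBruhat F ι') (w : ι' → AdeleRing (𝓞 F) F) :
    ((MpPsi.toOp (adelicSchrodinger F ι' (Matrix.reindex e e T)) (adelicMpReindex F e T p) Ψ : piSchwartzBruhat F ι') :
        (ι' → AdeleRing (𝓞 F) F) → ℂ) w =
      ((MpPsi.toOp (adelicSchrodinger F ι T) p ((piSBReindex F e).symm Ψ) : piSchwartzBruhat F ι) :
        (ι → AdeleRing (𝓞 F) F) → ℂ) (w ∘ e) :=
  rfl

/-- **the Weil representation is conjugated by `R_e`**: `ω_ψ(reindex p) Ψ = R_e (ω_ψ(p) (R_e⁻¹ Ψ))`.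
[cite: GelbartRogawski1991, §3.1 p. 454] -/
theorem omegaPsi_adelicMpReindex_apply (p : adelicMp F ι T) (Ψ : piSchwartzBruhat F ι') :
    omegaPsi (adelicSchrodinger F ι' (Matrix.reindex e e T)) (adelicMpReindex F e T p) Ψ =
      piSBReindex F e (omegaPsi (adelicSchrodinger F ι T) p ((piSBReindex F e).symm Ψ)) :=
  rfl

/-- **`π(reindex p) = spReindex e T (π p)`** (unitary-2's `spReindex = symplecticGroupCongr (reindexW e)`).
[cite: MoeglinVignerasWaldspurger1987, Chap. 2 II.1 (B)] -/
theorem proj_adelicMpReindex (p : adelicMp F ι T) :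
    MpPsi.proj (adelicSchrodinger F ι' (Matrix.reindex e e T)) (adelicMpReindex F e T p) =
      spReindex e T (MpPsi.proj (adelicSchrodinger F ι T) p) :=
  rfl

/-- pointwise: `π(reindex p) v = W_e (π(p) (W_e⁻¹ v))`. [folklore] -/
theorem coe_proj_adelicMpReindex_apply (p : adelicMp F ι T) (v : (ι' → AdeleRing (𝓞 F) F) × (ι' → AdeleRing (𝓞 F) F)) :
    ((MpPsi.proj (adelicSchrodinger F ι' (Matrix.reindex e e T)) (adelicMpReindex F e T p) :
        symplecticGroup (polar (adelicForm F ι' (Matrix.reindex e e T)))) :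
          ((ι' → AdeleRing (𝓞 F) F) × (ι' → AdeleRing (𝓞 F) F)) ≃ₗ[AdeleRing (𝓞 F) F]
            ((ι' → AdeleRing (𝓞 F) F) × (ι' → AdeleRing (𝓞 F) F))) v =
      reindexW (AdeleRing (𝓞 F) F) e
        (((MpPsi.proj (adelicSchrodinger F ι T) p : symplecticGroup (polar (adelicForm F ι T))) :
          ((ι → AdeleRing (𝓞 F) F) × (ι → AdeleRing (𝓞 F) F)) ≃ₗ[AdeleRing (𝓞 F) F]
            ((ι → AdeleRing (𝓞 F) F) × (ι → AdeleRing (𝓞 F) F))) ((reindexW (AdeleRing (𝓞 F) F) e).symm v)) :=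
  rfl

/-- **`Mp_ψ(W_𝔸)ᶜᵒⁿᵗ` is preserved** (`R_e M R_e⁻¹` is LF-continuous iff `M` is). [cite: GelbartRogawski1991, §3.1 p. 454] -/
theorem adelicMpReindex_mem_adelicMpCont_iff (p : adelicMp F ι T) :
    adelicMpReindex F e T p ∈ adelicMpCont F ι' (Matrix.reindex e e T) ↔ p ∈ adelicMpCont F ι T := by
  rw [mem_adelicMpCont_iff, mem_adelicMpCont_iff, toOp_adelicMpReindex]
  exact reindexConj_mem_lfUnits_iff _ e

/-- **`Θ`-fixing is preserved** (`Θ ∘ R_e = Θ`). [cite: Weil1964, Chap. III n° 41 Thm 6 p. 193] -/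
theorem adelicMpReindex_mem_adelicMpTheta_iff (p : adelicMp F ι T) :
    adelicMpReindex F e T p ∈ adelicMpTheta F ι' (Matrix.reindex e e T) ↔ p ∈ adelicMpTheta F ι T :=
  MpPsi.transport_mem_fixing_iff _ _ _ _ _ _ (thetaDistLM F ι' : piSchwartzBruhat F ι' → ℂ)
    (thetaDistLM F ι : piSchwartzBruhat F ι → ℂ) (fun Φ => thetaDistLM_piSBReindex F e Φ) p

/-- **the reindexing is continuous** for the coefficient topologies. [cite: Weil1964, Chap. III n° 39 p. 189] -/
theorem continuous_adelicMpReindex : Continuous (adelicMpReindex F e T) := by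
  refine (continuous_into_adelicMp_iff _).2 ⟨fun v => ?_, fun Ψ x => ?_⟩
  · have hc := continuous_proj_apply (F := F) (ι := ι) (T := T) ((reindexW (AdeleRing (𝓞 F) F) e).symm v)
    simp only [coe_proj_adelicMpReindex_apply, reindexW_apply]
    exact (continuous_pi fun i => (continuous_apply _).comp (continuous_fst.comp hc)).prodMk
      (continuous_pi fun i => (continuous_apply _).comp (continuous_snd.comp hc))
  · have h : ∀ q : adelicMp F ι T,
        ((omegaPsi (adelicSchrodinger F ι' (Matrix.reindex e e T)) (adelicMpReindex F e T q) Ψ : piSchwartzBruhat F ι') :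
          (ι' → AdeleRing (𝓞 F) F) → ℂ) x =
        ((omegaPsi (adelicSchrodinger F ι T) q ((piSBReindex F e).symm Ψ) : piSchwartzBruhat F ι) :
          (ι → AdeleRing (𝓞 F) F) → ℂ) (x ∘ e) := fun q => rfl
    simp only [h]
    exact continuous_omegaPsi_apply _ _

/-- **Uniqueness against `Θ`-fixing lifts**: `p ∈ Mp_ψ(W_T)^Θ`, `q ∈ Mp_ψ(W_{reindex T})^Θ`, `π(q) = spReindex e T (π p)`
imply `reindex p = q`. [cite: Weil1964, Chap. III n° 41 Thm 6 p. 193] -/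
theorem adelicMpReindex_eq_of_proj_eq
    (hT : Function.Surjective fun y : ι' → AdeleRing (𝓞 F) F => Matrix.reindex e e T *ᵥ y)
    {p : adelicMp F ι T} {q : adelicMp F ι' (Matrix.reindex e e T)} (hp : p ∈ adelicMpTheta F ι T)
    (hq : q ∈ adelicMpTheta F ι' (Matrix.reindex e e T))
    (h : MpPsi.proj (adelicSchrodinger F ι' (Matrix.reindex e e T)) q =
      spReindex e T (MpPsi.proj (adelicSchrodinger F ι T) p)) :
    adelicMpReindex F e T p = q :=
  adelicMp_eq_of_proj_eq hT ((adelicMpReindex_mem_adelicMpTheta_iff F e T p).2 hp) hq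
    (by rw [proj_adelicMpReindex, h])

end Reindex

/-! ## §4 The reindexing on the group of record `Mp_ψ(W_𝔸)ᶜᵒⁿᵗ` -/

section ReindexCont

variable (F : Type) [Field F] [NumberField F] {ι ι' : Type} [Fintype ι] [Fintype ι'] [DecidableEq ι] [DecidableEq ι']
  (e : ι ≃ ι') (T : Matrix ι ι (AdeleRing (𝓞 F) F))

/-- **THE REINDEXING OF RECORD `Mp_ψ(W_T)ᶜᵒⁿᵗ ≃* Mp_ψ(W_{reindex e e T})ᶜᵒⁿᵗ`.** [cite: GelbartRogawski1991, §3.1 p. 454] -/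
def adelicMpContReindex : adelicMpCont F ι T ≃* adelicMpCont F ι' (Matrix.reindex e e T) where
  toFun p := ⟨adelicMpReindex F e T p, (adelicMpReindex_mem_adelicMpCont_iff F e T _).2 p.2⟩
  invFun q := ⟨(adelicMpReindex F e T).symm q,
    (adelicMpReindex_mem_adelicMpCont_iff F e T _).1 (by rw [MulEquiv.apply_symm_apply]; exact q.2)⟩
  left_inv p := Subtype.ext ((adelicMpReindex F e T).symm_apply_apply _)
  right_inv q := Subtype.ext ((adelicMpReindex F e T).apply_symm_apply _)
  map_mul' p q := Subtype.ext (map_mul (adelicMpReindex F e T) _ _)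

/-- underlying pair of the reindexing of record. [folklore] -/
@[simp] theorem coe_adelicMpContReindex (p : adelicMpCont F ι T) :
    ((adelicMpContReindex F e T p : adelicMpCont F ι' (Matrix.reindex e e T)) : adelicMp F ι' (Matrix.reindex e e T)) =
      adelicMpReindex F e T p :=
  rfl

/-- underlying pair of the inverse reindexing of record. [folklore] -/
@[simp] theorem coe_adelicMpContReindex_symm (q : adelicMpCont F ι' (Matrix.reindex e e T)) :
    (((adelicMpContReindex F e T).symm q : adelicMpCont F ι T) : adelicMp F ι T) = (adelicMpReindex F e T).symm q :=
  rfl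

/-- **`ω(reindex p) Ψ = R_e (ω(p) (R_e⁻¹ Ψ))`** on the group of record. [cite: GelbartRogawski1991, §3.1 p. 454] -/
theorem adelicMpCont.omega_reindex_apply (p : adelicMpCont F ι T) (Ψ : piSchwartzBruhat F ι') :
    adelicMpCont.omega F ι' (Matrix.reindex e e T) (adelicMpContReindex F e T p) Ψ =
      piSBReindex F e (adelicMpCont.omega F ι T p ((piSBReindex F e).symm Ψ)) := by
  simp only [adelicMpCont.omega_apply, coe_adelicMpContReindex, omegaPsi_adelicMpReindex_apply]

/-- **`π ∘ reindex = spReindex e T ∘ π`** on the group of record. [cite: GelbartRogawski1991, §3.1 p. 454] -/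
theorem adelicMpCont.proj_reindex (p : adelicMpCont F ι T) :
    adelicMpCont.proj F ι' (Matrix.reindex e e T) (adelicMpContReindex F e T p) = spReindex e T (adelicMpCont.proj F ι T p) :=
  rfl

/-- `Θ`-fixing along the reindexing of record. [cite: Weil1964, Chap. III n° 41 Thm 6 p. 193] -/
theorem coe_adelicMpContReindex_mem_adelicMpTheta_iff (p : adelicMpCont F ι T) :
    ((adelicMpContReindex F e T p : adelicMpCont F ι' (Matrix.reindex e e T)) : adelicMp F ι' (Matrix.reindex e e T)) ∈
        adelicMpTheta F ι' (Matrix.reindex e e T) ↔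
      (p : adelicMp F ι T) ∈ adelicMpTheta F ι T :=
  adelicMpReindex_mem_adelicMpTheta_iff F e T p

/-- **the reindexing of record is continuous.** [cite: Weil1964, Chap. III n° 39 p. 189] -/
theorem continuous_adelicMpContReindex : Continuous (adelicMpContReindex F e T) :=
  (continuous_into_adelicMpCont_iff _).2 ((continuous_adelicMpReindex F e T).comp continuous_subtype_val)

end ReindexCont

/-! ## §5 Composition with splittings (consumer one-liners) -/

section Splittings

variable (F : Type) [Field F] [NumberField F] {P : Type*} [Group P]

/-- **A relabelled splitting has the same Weil representation**: for `s : P →* Mp_ψ(W_{T′})ᶜᵒⁿᵗ`,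
`ω_T ∘ (relabel ∘ s) = ω_{T′} ∘ s`. [folklore] -/
theorem adelicMpCont.omega_comp_relabel (ι : Type) [Fintype ι] [DecidableEq ι] {T T' : Matrix ι ι (AdeleRing (𝓞 F) F)}
    (C : GL ι (AdeleRing (𝓞 F) F)) (hC : T * (C : Matrix ι ι (AdeleRing (𝓞 F) F)) = T') (s : P →* adelicMpCont F ι T') :
    (adelicMpCont.omega F ι T).comp ((adelicMpContRelabel F ι C hC).toMonoidHom.comp s) =
      (adelicMpCont.omega F ι T').comp s :=
  MonoidHom.ext fun x => adelicMpCont.omega_relabel F ι C hC (s x)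

/-- **A reindexed splitting has the conjugated Weil representation**: for `s : P →* Mp_ψ(W_T)ᶜᵒⁿᵗ`,
`ω_{reindex T}((reindex ∘ s) x) Ψ = R_e (ω_T(s x) (R_e⁻¹ Ψ))`. [folklore] -/
theorem adelicMpCont.omega_comp_reindex_apply {ι ι' : Type} [Fintype ι] [Fintype ι'] [DecidableEq ι] [DecidableEq ι']
    (e : ι ≃ ι') (T : Matrix ι ι (AdeleRing (𝓞 F) F)) (s : P →* adelicMpCont F ι T) (x : P)
    (Ψ : piSchwartzBruhat F ι') :
    (adelicMpCont.omega F ι' (Matrix.reindex e e T)).comp ((adelicMpContReindex F e T).toMonoidHom.comp s) x Ψ =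
      piSBReindex F e (adelicMpCont.omega F ι T (s x) ((piSBReindex F e).symm Ψ)) :=
  adelicMpCont.omega_reindex_apply F e T (s x) Ψ

end Splittings

end Literature.NumberTheory.Weil1964
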